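import Summits.MatrixMultiplication.MatrixMultiplication.Theses.SupportSparsity

/-!
# `SparseExponentTwo` — anatomy of the deciding crux (crux-strategist census artefact, 2026-08-17)

Kernel-checked facts cited by `Cruxes/SparseExponentTwo/STRATEGY-CENSUS.md`
(unit `cstrat-stmt-MatrixMultiplication-7399-r1`, BC2-redirect re-audit of route `SupportSparsity`).

* `sparseExponentTwo_iff` — **X ↔ MatrixMultiplication ∧ SparsitySufficiency**: the one seam the crux has.
  Its converse direction `sparseExponentTwo_of_summit_of_sufficiency` is a three-line rewrite of `ω = 2`
  (a *trivial seam* in the sense of BC2 (b)), and one of its pieces *is* the summit (BC2 (c)).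
* `SparseDecomp` / `sparseExponentTwo_iff_sparseDecomp` — the route's inlined predicate with the three
  support budgets separated, so that the asymmetric candidates can be typed.
* Decomposition candidates typed for the census: `SparseTwoLegs` (D2), `Bootstrap` (D3),
  `SparseExponentTwoOver` / `SparseLiftingFromCharTwo` (D7), `FewGeneratorOrbitSchemes` (D8).
* `not_sparseTwoLegs_of_sparsityLowerBound` — D2 is **refuted** by the route's own support item
  `SparsityLowerBound` (the incidence curve `r·s ≥ n³`): with `√n`-sparse A-legs, `r ≥ n^{5/2}`.
* `sparseExponentTwo_of_milestone_of_bootstrap` — D3's assembly is literally modus ponens.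

Nothing here proves or refutes an item; `SparsityLowerBound` (stmt-7406) enters only as a hypothesis.
-/

namespace Summit.MatrixMultiplication.MatrixMultiplication.Cruxes.SparseExponentTwo.Anatomy

open Literature.Computability.AlgebraicComplexity
open Summit.MatrixMultiplication.MatrixMultiplication.Theses.SupportSparsity

/-! ## The seam `X ↔ S ∧ SparsitySufficiency` -/

/-- `X → SparsitySufficiency`: since `2 ≤ ω(ℂ)` (`omega_two_le`), `n^(2+ε) ≤ n^(ω+ε)`. -/
theorem sparsitySufficiency_of_sparseExponentTwo (h : SparseExponentTwo) : SparsitySufficiency := by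
  intro ε hε
  obtain ⟨n, hn, r, hr, w, u, v, hdec, hsp⟩ := h ε hε
  refine ⟨n, hn, r, ?_, w, u, v, hdec, hsp⟩
  have hn1 : (1 : ℝ) ≤ n := by exact_mod_cast (le_trans (by norm_num) hn : 1 ≤ n)
  have h2 : (2 : ℝ) + ε ≤ omega ℂ + ε := by linarith [omega_two_le ℂ]
  exact hr.trans (Real.rpow_le_rpow_of_exponent_le hn1 h2)

/-- **The trivial seam.** `S ∧ SparsitySufficiency → X` is a rewrite of `ω(ℂ) = 2` inside the
existential — three lines, no mathematics. -/
theorem sparseExponentTwo_of_summit_of_sufficiency (hS : _root_.MatrixMultiplication)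
    (h : SparsitySufficiency) : SparseExponentTwo := by
  intro ε hε
  have hω : omega ℂ = 2 := hS
  obtain ⟨n, hn, r, hr, rest⟩ := h ε hε
  rw [hω] at hr
  exact ⟨n, hn, r, hr, rest⟩

/-- **Anatomy of the deciding crux**: `SparseExponentTwo ↔ MatrixMultiplication ∧ SparsitySufficiency`
(`→`: the route's `closes` forgets sparsity, and `omega_two_le`; `←`: the trivial seam). -/
theorem sparseExponentTwo_iff :
    SparseExponentTwo ↔ _root_.MatrixMultiplication ∧ SparsitySufficiency :=
  ⟨fun h => ⟨closes h, sparsitySufficiency_of_sparseExponentTwo h⟩,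
   fun h => sparseExponentTwo_of_summit_of_sufficiency h.1 h.2⟩

/-! ## The inlined predicate with separated budgets -/

/-- `SparseDecomp n r sw su sv`: `⟨n,n,n⟩` over `ℂ` is a sum of `r` triads whose output legs have at most
`sw`, whose `A`-legs at most `su` and whose `B`-legs at most `sv` non-zero entries (route convention:
`w` = output coefficients on `Fin n × Fin n = (κ,ν)`, `u` = form on `A = (κ,μ)`, `v` = form on `B = (μ,ν)`). -/
def SparseDecomp (n r sw su sv : ℕ) : Prop :=
  ∃ (w u v : Fin r → Fin n × Fin n → ℂ), matMulTensor ℂ n n n = ∑ i, triad (w i) (u i) (v i) ∧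
    ∀ i, (Finset.univ.filter fun p : Fin n × Fin n => w i p ≠ 0).card ≤ sw ∧
      (Finset.univ.filter fun p : Fin n × Fin n => u i p ≠ 0).card ≤ su ∧
      (Finset.univ.filter fun p : Fin n × Fin n => v i p ≠ 0).card ≤ sv

/-- The crux in terms of `SparseDecomp` (definitional). -/
theorem sparseExponentTwo_iff_sparseDecomp :
    SparseExponentTwo ↔ ∀ ε : ℝ, 0 < ε → ∃ n : ℕ, 2 ≤ n ∧ ∃ r : ℕ, (r : ℝ) ≤ (n : ℝ) ^ (2 + ε) ∧
      SparseDecomp n r n n n :=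
  Iff.rfl

/-! ## D2 — asymmetric support budgets `(√n, √n, n²)` (refuted by the incidence curve) -/

/-- D2 piece: exponent two with `√n`-sparse `A`- and `B`-legs and unconstrained output legs; the
Kronecker cube of its three cyclic rotations would be Strassen-sparse (`√n·√n·n² = n³ = side`). -/
def SparseTwoLegs : Prop :=
  ∀ ε : ℝ, 0 < ε → ∃ n : ℕ, 2 ≤ n ∧ ∃ r : ℕ, (r : ℝ) ≤ (n : ℝ) ^ (2 + ε) ∧
    SparseDecomp n r (n * n) (Nat.sqrt n) (Nat.sqrt n)

/-- **D2 is refuted by the route's own support item** `SparsityLowerBound` (`k·m·n ≤ r·s` whenever the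
`A`-legs are `s`-sparse): at `ε = 1/4`, `n³ ≤ r·⌊√n⌋ ≤ n^{9/4}·n^{1/2} < n³`. Integer form:
`(r·⌊√n⌋)⁴ ≤ n⁹·n² = n¹¹ < n¹² = (n³)⁴`. -/
theorem not_sparseTwoLegs_of_sparsityLowerBound (hL : SparsityLowerBound) : ¬ SparseTwoLegs := by
  intro h
  obtain ⟨n, hn, r, hr, w, u, v, hdec, hsp⟩ := h (1 / 4) (by norm_num)
  have hinc : n * n * n ≤ r * Nat.sqrt n :=
    hL ℂ n n n r (Nat.sqrt n) w u v hdec (fun i => (hsp i).2.1)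
  have hn0 : (0 : ℝ) ≤ n := Nat.cast_nonneg n
  -- (1) r⁴ ≤ n⁹ from r ≤ n^(9/4)
  have hr4 : r ^ 4 ≤ n ^ 9 := by
    have h1 : (r : ℝ) ^ (4 : ℕ) ≤ ((n : ℝ) ^ (2 + 1 / 4 : ℝ)) ^ (4 : ℕ) :=
      pow_le_pow_left₀ (Nat.cast_nonneg r) hr 4
    have h2 : ((n : ℝ) ^ (2 + 1 / 4 : ℝ)) ^ (4 : ℕ) = ((n ^ 9 : ℕ) : ℝ) := by
      rw [← Real.rpow_mul_natCast hn0]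
      norm_num
    rw [h2] at h1
    exact_mod_cast h1
  -- (2) ⌊√n⌋⁴ ≤ n²
  have hs4 : Nat.sqrt n ^ 4 ≤ n ^ 2 := by
    have hs := Nat.sqrt_le' n
    calc Nat.sqrt n ^ 4 = (Nat.sqrt n ^ 2) ^ 2 := by ring
      _ ≤ n ^ 2 := Nat.pow_le_pow_left hs 2
  -- (3) (r·⌊√n⌋)⁴ ≤ n¹¹ < (n³)⁴
  have hprod : (r * Nat.sqrt n) ^ 4 ≤ n ^ 11 := by
    calc (r * Nat.sqrt n) ^ 4 = r ^ 4 * Nat.sqrt n ^ 4 := by ring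
      _ ≤ n ^ 9 * n ^ 2 := Nat.mul_le_mul hr4 hs4
      _ = n ^ 11 := by ring
  have hlt : n ^ 11 < (n * n * n) ^ 4 := by
    have h' : (n * n * n) ^ 4 = n ^ 11 * n := by ring
    rw [h']
    exact lt_mul_of_one_lt_right (pow_pos (by omega) 11) (by omega)
  have h4 : (n * n * n) ^ 4 ≤ (r * Nat.sqrt n) ^ 4 := Nat.pow_le_pow_left hinc 4
  exact lt_irrefl _ (((h4.trans hprod)).trans_lt hlt)

/-! ## D3 — milestone + bootstrap (a modus-ponens seam) -/

/-- D3 second piece: "beating the mixing floor already gives exponent two" — the upgrade implication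
itself, with no mechanism behind it. -/
def Bootstrap : Prop := SparseBelowMixingFloor → SparseExponentTwo

/-- D3's assembly is modus ponens: a one-term seam, rejected by BC2 (b). -/
theorem sparseExponentTwo_of_milestone_of_bootstrap (h₁ : SparseBelowMixingFloor) (h₂ : Bootstrap) :
    SparseExponentTwo :=
  h₂ h₁

/-! ## D7 — field transfer -/

/-- D7: the crux over an arbitrary field `K` (same shape, coefficients in `K`). -/
def SparseExponentTwoOver (K : Type) [Field K] [DecidableEq K] : Prop :=
  ∀ ε : ℝ, 0 < ε → ∃ n : ℕ, 2 ≤ n ∧ ∃ r : ℕ, (r : ℝ) ≤ (n : ℝ) ^ (2 + ε) ∧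
    ∃ (w u v : Fin r → Fin n × Fin n → K), matMulTensor K n n n = ∑ i, triad (w i) (u i) (v i) ∧
      ∀ i, (Finset.univ.filter fun p : Fin n × Fin n => w i p ≠ 0).card ≤ n ∧
        (Finset.univ.filter fun p : Fin n × Fin n => u i p ≠ 0).card ≤ n ∧
        (Finset.univ.filter fun p : Fin n × Fin n => v i p ≠ 0).card ≤ n

/-- Over `ℂ` it is the crux, definitionally. -/
theorem sparseExponentTwoOver_complex : SparseExponentTwoOver ℂ ↔ SparseExponentTwo := Iff.rfl

/-- D7 lifting piece (characteristic `2` → `ℂ`), in the only form we can type today (pointwise), which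
makes the assembly modus ponens again. -/
def SparseLiftingFromCharTwo : Prop :=
  ∀ (F : Type) [Field F] [DecidableEq F] [CharP F 2], SparseExponentTwoOver F → SparseExponentTwo

/-! ## D8 — few-generator orbit schemes (a strengthening of the crux) -/

/-- D8: `⟨n,n,n⟩` as the sum of the `ℤ_n × ℤ_n`-orbits (cyclic shift of the row index `κ` by `g.1` on `A`
and `C`, of the inner index `μ` by `g.2` on `A` and `B`) of `k ≤ n^ε` Strassen-sparse generating triads:
`r = k·n²` terms, exponent `2 + ε`.  The shifts preserve supports, so this is a special form of witness
for the crux — a strengthening, reached from it by no known argument and implying it by orbit expansion. -/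
def FewGeneratorOrbitSchemes : Prop :=
  ∀ ε : ℝ, 0 < ε → ∃ n : ℕ, 2 ≤ n ∧ ∃ k : ℕ, (k : ℝ) ≤ (n : ℝ) ^ ε ∧
    ∃ (w u v : Fin k → Fin n × Fin n → ℂ),
      matMulTensor ℂ n n n =
        ∑ g : Fin n × Fin n, ∑ j : Fin k,
          triad (fun p : Fin n × Fin n => w j (p.1 - g.1, p.2))
            (fun p : Fin n × Fin n => u j (p.1 - g.1, p.2 - g.2))
            (fun p : Fin n × Fin n => v j (p.1 - g.2, p.2)) ∧
      ∀ j, (Finset.univ.filter fun p : Fin n × Fin n => w j p ≠ 0).card ≤ n ∧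
        (Finset.univ.filter fun p : Fin n × Fin n => u j p ≠ 0).card ≤ n ∧
        (Finset.univ.filter fun p : Fin n × Fin n => v j p ≠ 0).card ≤ n

end Summit.MatrixMultiplication.MatrixMultiplication.Cruxes.SparseExponentTwo.Anatomy
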